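import Literature.Topology.FourManifolds.TrisectionsImplant
import Literature.Topology.FourManifolds.TrisectionsImplantModelBox
import Literature.Topology.FourManifolds.TrisectionsImplantFace
import Literature.Topology.FourManifolds.TrisectionsFaceLambdaConst
import HarnessLib

/-!
# The unbalanced stabilisation with its faces (one implant, sectors and faces)

Topic `Literature/Topology/FourManifolds`; infrastructure for the fact seat
`provefact-Literature.Topology.FourManifolds.exists-14560f9fc8` (named fact (c′)
`Literature.Topology.FourManifolds.exists_stabilized_gkTrisection`, Gay–Kirby 2016, Def. 8 and
Lemma 10).  Everything in this file is **proved**; no definitions, no named facts.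

**Theorem (`TriNormalForm.exists_implantF`).**  `TriNormalForm.exists_implant`
(`TrisectionsImplant.lean`: one unbalanced stabilisation of a trisection in normal form)
together with the three **faces**: if the faces `S i ∩ S j`, `S j ∩ S l`, `S l ∩ S i` are faces
in normal form (`FaceNormalForm`, counts `cf₁, cf₂, cf₃`), then so are the faces of the
stabilised trisection, with counts `cfₖ n + [n = 1]` (each face gains one `1`-handle: over the
carrier the faces are the graphs `x₃ = N`, `x₃ = 0`, `x₃ = -N` of the birth function, on which
the collar function is `1 + λ₀ N`, `1 - λ₀ N / 2`, `1 + λ₀ N`; Gay–Kirby 2016, proof of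
Lemma 10).  The construction is that of `TriNormalForm.exists_implant` verbatim (with the implant
ball also inside the regions where the face collar coefficients are constant,
`FaceNormalForm.exists_morse_const`, and free of old face critical points), followed by
`face_of_implant` for the three faces.

## References

* D. Gay, R. Kirby, *Trisecting 4-manifolds*, Geom. Topol. 20 (2016), Def. 8, Lemma 10 and its
  proof. [GayKirby2016]
* J. Milnor, *Lectures on the h-cobordism theorem* (1965), Lemma 8.2. [MilnorHCobordism1965]
-/

open scoped Manifold ContDiff Topology Classical
open Set Function Filter Metric

noncomputable section

namespace Literature.Topology.FourManifolds

universe u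

section ImplantF

variable {X : Type u} [TopologicalSpace X] [T2Space X] [CompactSpace X]
  [ChartedSpace (EuclideanSpace ℝ (Fin 4)) X] [IsManifold (𝓡 4) ∞ X]
  {S : Fin 3 → Set X} {i j l : Fin 3} {u v : X → ℝ} {ρ : X → X} {U O : Set X}
  {c : Fin 3 → ℕ → ℕ}

omit [T2Space X] [CompactSpace X] in
/-- **A non-critical point of a restriction has a neighbourhood in `X` free of critical
points** (the critical set is closed). [folklore] -/
theorem exists_open_forall_not_isMCriticalPt {Q : Set X} (Φ : BoundarySliceAtlas 2 Q)
    {G : X → ℝ} (hGs : ContMDiff (𝓡 4) 𝓘(ℝ, ℝ) ∞ G) {x : X} (hxQ : x ∈ Q)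
    (hx : letI := Φ.chartedSpace; ¬ IsMCriticalPt (𝓡∂ 3) (G ∘ Subtype.val : ↥Q → ℝ) ⟨x, hxQ⟩) :
    ∃ Ox : Set X, IsOpen Ox ∧ x ∈ Ox ∧
      letI := Φ.chartedSpace
      ∀ p : ↥Q, p.1 ∈ Ox → ¬ IsMCriticalPt (𝓡∂ 3) (G ∘ Subtype.val : ↥Q → ℝ) p := by
  letI := Φ.chartedSpace
  haveI := Φ.isManifold
  have hGval : ContMDiff (𝓡∂ 3) 𝓘(ℝ, ℝ) ∞ (G ∘ Subtype.val : ↥Q → ℝ) := hGs.comp Φ.contMDiff_subtype_val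
  have hopen : IsOpen ((criticalSet (𝓡∂ 3) (G ∘ Subtype.val : ↥Q → ℝ))ᶜ) :=
    (isClosed_criticalSet_of_contMDiff hGval (by norm_cast)).isOpen_compl
  obtain ⟨Ox, hOxo, hOxeq⟩ := isOpen_induced_iff.1 hopen
  refine ⟨Ox, hOxo, ?_, fun p hp hcr => ?_⟩
  · have : (⟨x, hxQ⟩ : ↥Q) ∈ Subtype.val ⁻¹' Ox := by rw [hOxeq]; exact hx
    exact this
  · have : p ∈ Subtype.val ⁻¹' Ox := hp
    rw [hOxeq] at this
    exact this hcr

set_option maxHeartbeats 1600000 in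
/-- **The unbalanced stabilisation with its faces.**  See the module docstring.
[cite: GayKirby2016, Def. 8, Lemma 10 and its proof] -/
theorem TriNormalForm.exists_implantF (hT : TriNormalForm S i j l u v ρ U O c)
    {cf₁ cf₂ cf₃ : ℕ → ℕ}
    (hQij : FaceNormalForm (S i ∩ S j) (⋂ m, S m) u v U cf₁)
    (hQjl : FaceNormalForm (S j ∩ S l) (⋂ m, S m) (fun y => v y - u y) (fun y => -u y) U cf₂)
    (hQli : FaceNormalForm (S l ∩ S i) (⋂ m, S m) (fun y => -v y) (fun y => u y - v y) U cf₃)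
    {x : X} (hx : x ∈ ⋂ m, S m) {Ω : Set X} (hΩ : IsOpen Ω) (hxΩ : x ∈ Ω) :
    ∃ (S' : Fin 3 → Set X) (u' v' : X → ℝ) (ρ' : X → X) (O' : Set X),
      TriNormalForm S' i j l u' v' ρ' U O'
        (Function.update c i (fun n => c i n + if n = 1 then 1 else 0)) ∧
      (∀ m, ∀ y ∉ Ω, y ∈ S' m ↔ y ∈ S m) ∧ (∀ y ∉ Ω, u' y = u y ∧ v' y = v y) ∧
      FaceNormalForm (S' i ∩ S' j) (⋂ m, S' m) u' v' U (fun n => cf₁ n + if n = 1 then 1 else 0) ∧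
      FaceNormalForm (S' j ∩ S' l) (⋂ m, S' m) (fun y => v' y - u' y) (fun y => -u' y) U
        (fun n => cf₂ n + if n = 1 then 1 else 0) ∧
      FaceNormalForm (S' l ∩ S' i) (⋂ m, S' m) (fun y => -v' y) (fun y => u' y - v' y) U
        (fun n => cf₃ n + if n = 1 then 1 else 0) := by
  -- ### face data with constant collar coefficients near `x`
  obtain ⟨Φij, Gij, lamij, Olij, Bxij, hdetij, hGijs, hlamijs, hOlijo, hFOlij, hOlijU, hlamijpos, hGijform,
    hGijlt, ⟨hcritij, hcountij⟩, hBxijo, hxBxij, hBxijOl, hlamijconst⟩ := hQij.exists_morse_const hx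
  obtain ⟨Φjl, Gjl, lamjl, Oljl, Bxjl, hdetjl, hGjls, hlamjls, hOljlo, hFOljl, hOljlU, hlamjlpos, hGjlform,
    hGjllt, ⟨hcritjl, hcountjl⟩, hBxjlo, hxBxjl, hBxjlOl, hlamjlconst⟩ := hQjl.exists_morse_const hx
  obtain ⟨Φli, Gli, lamli, Olli, Bxli, hdetli, hGlis, hlamlis, hOllio, hFOlli, hOlliU, hlamlipos, hGliform,
    hGlilt, ⟨hcritli, hcountli⟩, hBxlio, hxBxli, hBxliOl, hlamliconst⟩ := hQli.exists_morse_const hx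
  -- neighbourhoods of `x` free of face critical points
  have hxij : x ∈ S i ∩ S j := hQij.F_subset hx
  have hxjl : x ∈ S j ∩ S l := hQjl.F_subset hx
  have hxli : x ∈ S l ∩ S i := hQli.F_subset hx
  obtain ⟨Oij, hOijo, hxOij, hnocOij⟩ := exists_open_forall_not_isMCriticalPt Φij hGijs hxij
    (fun h => (hcritij _ h).1 hx)
  obtain ⟨Ojl, hOjlo, hxOjl, hnocOjl⟩ := exists_open_forall_not_isMCriticalPt Φjl hGjls hxjl
    (fun h => (hcritjl _ h).1 hx)
  obtain ⟨Oli, hOlio, hxOli, hnocOli⟩ := exists_open_forall_not_isMCriticalPt Φli hGlis hxli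
    (fun h => (hcritli _ h).1 hx)
  -- the smaller region
  set Ω' : Set X := Ω ∩ ((Bxij ∩ Oij) ∩ (Bxjl ∩ Ojl) ∩ (Bxli ∩ Oli)) with hΩ'def
  have hΩ' : IsOpen Ω' := hΩ.inter (((hBxijo.inter hOijo).inter (hBxjlo.inter hOjlo)).inter (hBxlio.inter hOlio))
  have hxΩ' : x ∈ Ω' := ⟨hxΩ, ⟨⟨hxBxij, hxOij⟩, ⟨hxBxjl, hxOjl⟩⟩, ⟨hxBxli, hxOli⟩⟩
  have hΩ'Ω : Ω' ⊆ Ω := inter_subset_left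
  -- ### the construction of `TriNormalForm.exists_implant`, inside `Ω'`
  have hfr := hT.frame
  have hij := hT.ne_ij
  have hjl := hT.ne_jl
  have hil := hT.ne_il
  -- ### ambient presentations with corner coefficients constant near `x`
  obtain ⟨Gi, κi, Oκi, Bxi, hGis, hκis, hOκio, hFOκi, hOκiO, hκipos, hκiρ, hGiform, hb1i, hi1i, hb2i,
    hi2i, hnocriti, hci, hBxio, hxBxi, hBxiOκ, hκiconst⟩ := hT.sector_i.exists_morse_const hfr hx
  obtain ⟨Gj, κj, Oκj, Bxj, hGjs, hκjs, hOκjo, hFOκj, hOκjO, hκjpos, hκjρ, hGjform, hb1j, hi1j, hb2j,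
    hi2j, hnocritj, hcj, hBxjo, hxBxj, hBxjOκ, hκjconst⟩ :=
    hT.sector_j.exists_morse_const hfr.relabelTriRot hx
  obtain ⟨Gl, κl, Oκl, Bxl, hGls, hκls, hOκlo, hFOκl, hOκlO, hκlpos, hκlρ, hGlform, hb1l, hi1l, hb2l,
    hi2l, hnocritl, hcl, hBxlo, hxBxl, hBxlOκ, hκlconst⟩ :=
    hT.sector_l.exists_morse_const hfr.relabelTriRot₂ hx
  -- ### the chart `Θt = A ∘ C.Θ`
  obtain ⟨C, hxC, hCO⟩ := hT.sector_i.corner x hx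
  let Alin : EuclideanSpace ℝ (Fin 4) ≃ₗ[ℝ] EuclideanSpace ℝ (Fin 4) :=
    { toFun := fun y => !₂[-(y 0 + y 1), y 2, y 3, y 0 - y 1]
      invFun := fun z => !₂[(z 3 - z 0) / 2, (-z 3 - z 0) / 2, z 1, z 2]
      map_add' := fun y y' => by
        ext k; fin_cases k
        · simp; ring
        · simp
        · simp
        · simp; ring
      map_smul' := fun r y => by
        ext k; fin_cases k
        · simp; ring
        · simp
        · simp
        · simp; ring
      left_inv := fun y => by
        ext k; fin_cases k
        · simp; ring
        · simp; ring
        · simp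
        · simp
      right_inv := fun z => by
        ext k; fin_cases k
        · simp; ring
        · simp
        · simp
        · simp; ring }
  set A : EuclideanSpace ℝ (Fin 4) ≃L[ℝ] EuclideanSpace ℝ (Fin 4) := Alin.toContinuousLinearEquiv with hAdef
  have hA0 : ∀ y, A y 0 = -(y 0 + y 1) := fun y => rfl
  have hA1 : ∀ y, A y 1 = y 2 := fun y => rfl
  have hA2 : ∀ y, A y 2 = y 3 := fun y => rfl
  have hA3 : ∀ y, A y 3 = y 0 - y 1 := fun y => rfl
  set Θt : OpenPartialHomeomorph X (EuclideanSpace ℝ (Fin 4)) := C.Θ.transHomeomorph A.toHomeomorph with hΘt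
  have hΘtsrc : Θt.source = C.Θ.source := OpenPartialHomeomorph.transHomeomorph_source _ _
  have hΘtapply : ∀ y, Θt y = A (C.Θ y) := fun y => rfl
  have hΘtmem : Θt ∈ IsManifold.maximalAtlas (𝓡 4) ∞ X := by
    rw [hΘt, OpenPartialHomeomorph.transHomeomorph_eq_trans]
    refine trans_mem_maximalAtlas C.Θ_mem_maximalAtlas (contDiffGroupoid_mem_of_contDiffOn_symm ?_ ?_)
    · exact A.contDiff.contDiffOn
    · exact A.symm.contDiff.contDiffOn
  -- the normal coordinates in the chart
  have hu_src : ∀ y ∈ Θt.source, u y = (fun z : EuclideanSpace ℝ (Fin 4) => (z 3 - z 0) / 2) (Θt y) := by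
    intro y hy
    rw [hΘtsrc] at hy
    simp only [hΘtapply, hA0, hA3, C.apply_zero y hy, C.apply_one y hy]
    ring
  have hv_src : ∀ y ∈ Θt.source, v y = (fun z : EuclideanSpace ℝ (Fin 4) => (-z 3 - z 0) / 2) (Θt y) := by
    intro y hy
    rw [hΘtsrc] at hy
    simp only [hΘtapply, hA0, hA3, C.apply_zero y hy, C.apply_one y hy]
    ring
  set qs : EuclideanSpace ℝ (Fin 4) := Θt x with hqsdef
  have hxU : x ∈ U := hfr.F_subset_U hx
  obtain ⟨hux, hvx⟩ := (hfr.memF_iff x hxU).1 hx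
  have hqs0 : qs 0 = 0 := by
    rw [hqsdef, hΘtapply, hA0, C.apply_zero x hxC, C.apply_one x hxC, hux, hvx]; ring
  have hqs3 : qs 3 = 0 := by
    rw [hqsdef, hΘtapply, hA3, C.apply_zero x hxC, C.apply_one x hxC, hux, hvx]; ring
  have hxsrc : x ∈ Θt.source := by rw [hΘtsrc]; exact hxC
  -- ### the region `W` around `x` and the radius `R`
  set W : Set X := Ω' ∩ O ∩ ((Bxi ∩ Oκi) ∩ (Bxj ∩ Oκj) ∩ (Bxl ∩ Oκl)) with hW
  have hWo : IsOpen W := (hΩ'.inter hfr.isOpen_O).inter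
    (((hBxio.inter hOκio).inter (hBxjo.inter hOκjo)).inter (hBxlo.inter hOκlo))
  have hxW : x ∈ W := ⟨⟨hxΩ', hfr.F_subset_O hx⟩, ⟨⟨hxBxi, hBxiOκ hxBxi⟩, ⟨hxBxj, hBxjOκ hxBxj⟩⟩,
    ⟨hxBxl, hBxlOκ hxBxl⟩⟩
  set D : Set (EuclideanSpace ℝ (Fin 4)) := Θt.target ∩ Θt.symm ⁻¹' W with hD
  have hDo : IsOpen D := Θt.continuousOn_symm.isOpen_inter_preimage Θt.open_target hWo
  have hqsD : qs ∈ D := ⟨Θt.map_source hxsrc, by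
    show Θt.symm (Θt x) ∈ W; rw [Θt.left_inv hxsrc]; exact hxW⟩
  obtain ⟨r₀, hr₀, hballD⟩ := Metric.isOpen_iff.1 hDo qs hqsD
  set R : ℝ := r₀ / 2 with hRdef
  have hR : 0 < R := by positivity
  have hcballD : closedBall qs R ⊆ D := (closedBall_subset_ball (by rw [hRdef]; linarith)).trans hballD
  -- ### the model
  obtain ⟨uN, vN, xs, N, K, P₀, z₀, z₁, huNs, hvNs, hdiffN, ⟨hKbc, hKbball, hout⟩, hduN, hdvN, hΨ,
    hxsball, huxs, hvxs, hcritxs, hndxs, hidxxs, huniq, hnoj, hnol, hf1, hf2, hf3, hf4, hf5, hf6,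
    ⟨hP₀, hKc, hNmorse, hNK, hNcrit, hz₀₁, hiz₀, hiz₁, hNz₀, hNz₁, hxsz₀, hxs3, hslab, hsmallN, hfaces,
      hgraphball⟩⟩ := Implant.exists_implant₃ qs hqs0 hqs3 hR
  set Kb : Set (EuclideanSpace ℝ (Fin 4)) := {y | |y 3| ≤ 3 / 2 * P₀ ∧ dropLast 2 y ∈ K} with hKbdef
  have hKbT : Kb ⊆ Θt.target := fun z hz => (hcballD (ball_subset_closedBall (hKbball hz))).1
  have hballT : ball qs R ⊆ Θt.target := fun z hz => (hcballD (ball_subset_closedBall hz)).1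
  have hballW : ∀ z ∈ ball qs R, Θt.symm z ∈ W := fun z hz => (hcballD (ball_subset_closedBall hz)).2
  -- ### the glued coordinates
  set u' : X → ℝ := Θt.source.piecewise (uN ∘ Θt) u with hu'def
  set v' : X → ℝ := Θt.source.piecewise (vN ∘ Θt) v with hv'def
  set KX : Set X := Θt.symm '' Kb with hKXdef
  obtain ⟨hKXc, hKXsrc⟩ := isCompact_symm_image (Θ := Θt) hKbc hKbT
  have hKXW : KX ⊆ W := by
    rintro _ ⟨z, hz, rfl⟩; exact hballW z (hKbball hz)
  have houtu : ∀ z ∉ Kb, uN z = (fun z : EuclideanSpace ℝ (Fin 4) => (z 3 - z 0) / 2) z :=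
    fun z hz => (hout z hz).1
  have houtv : ∀ z ∉ Kb, vN z = (fun z : EuclideanSpace ℝ (Fin 4) => (-z 3 - z 0) / 2) z :=
    fun z hz => (hout z hz).2
  have hu's : ContMDiff (𝓡 4) 𝓘(ℝ, ℝ) ∞ u' :=
    contMDiff_piecewise hΘtmem hfr.contMDiff_u huNs hu_src hKbc hKbT houtu
  have hv's : ContMDiff (𝓡 4) 𝓘(ℝ, ℝ) ∞ v' :=
    contMDiff_piecewise hΘtmem hfr.contMDiff_v hvNs hv_src hKbc hKbT houtv
  have hu'eq : ∀ y ∉ KX, u' y = u y := fun y hy => piecewise_eq_of_not_mem hu_src houtu hy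
  have hv'eq : ∀ y ∉ KX, v' y = v y := fun y hy => piecewise_eq_of_not_mem hv_src houtv hy
  have hu'src : ∀ y ∈ Θt.source, u' y = uN (Θt y) := fun y hy => piecewise_eq_of_mem_source hy
  have hv'src : ∀ y ∈ Θt.source, v' y = vN (Θt y) := fun y hy => piecewise_eq_of_mem_source hy
  have hsrcU : Θt.source ⊆ U := by rw [hΘtsrc]; exact hCO.trans hfr.O_subset_U
  have hKXU : KX ⊆ U := hKXsrc.trans hsrcU
  have hKXΩ' : KX ⊆ Ω' := fun y hy => (hKXW hy).1.1
  have hKXBxi : KX ⊆ Bxi := fun y hy => (hKXW hy).2.1.1.1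
  have hKXBxj : KX ⊆ Bxj := fun y hy => (hKXW hy).2.1.2.1
  have hKXBxl : KX ⊆ Bxl := fun y hy => (hKXW hy).2.2.1
  -- ### the wedge conditions
  set Pm : Fin 3 → ℝ → ℝ → Prop := fun m a b =>
    (m = i → 0 ≤ a ∧ 0 ≤ b) ∧ (m = j → a ≤ 0 ∧ a ≤ b) ∧ (m = l → b ≤ 0 ∧ b ≤ a) with hPm
  have hPi : ∀ a b, Pm i a b ↔ 0 ≤ a ∧ 0 ≤ b := fun a b =>
    ⟨fun h => h.1 rfl, fun h => ⟨fun _ => h, fun h' => absurd h' hij, fun h' => absurd h' hil⟩⟩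
  have hPj : ∀ a b, Pm j a b ↔ a ≤ 0 ∧ a ≤ b := fun a b =>
    ⟨fun h => h.2.1 rfl, fun h => ⟨fun h' => absurd h'.symm hij, fun _ => h, fun h' => absurd h' hjl⟩⟩
  have hPl : ∀ a b, Pm l a b ↔ b ≤ 0 ∧ b ≤ a := fun a b =>
    ⟨fun h => h.2.2 rfl, fun h => ⟨fun h' => absurd h'.symm hil, fun h' => absurd h'.symm hjl, fun _ => h⟩⟩
  have hcovP : ∀ a b : ℝ, ∃ m, Pm m a b := by
    intro a b
    by_cases h1 : 0 ≤ a ∧ 0 ≤ b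
    · exact ⟨i, (hPi a b).2 h1⟩
    · by_cases h2 : a ≤ b
      · refine ⟨j, (hPj a b).2 ⟨?_, h2⟩⟩
        by_contra ha; push Not at ha h1
        exact absurd (h1 ha.le) (not_lt.2 (ha.le.trans h2))
      · refine ⟨l, (hPl a b).2 ⟨?_, (not_le.1 h2).le⟩⟩
        by_contra hb; push Not at hb h1
        have hba := not_le.1 h2
        exact absurd (h1 (hb.le.trans hba.le)) (not_lt.2 hb.le)
  have hmeetP : ∀ a b : ℝ, (∀ m, Pm m a b) ↔ a = 0 ∧ b = 0 := by
    intro a b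
    constructor
    · intro h
      have h1 := (hPi a b).1 (h i); have h2 := (hPj a b).1 (h j); have h3 := (hPl a b).1 (h l)
      exact ⟨le_antisymm h2.1 h1.1, le_antisymm h3.1 h1.2⟩
    · rintro ⟨rfl, rfl⟩ m
      exact ⟨fun _ => ⟨le_rfl, le_rfl⟩, fun _ => ⟨le_rfl, le_rfl⟩, fun _ => ⟨le_rfl, le_rfl⟩⟩
  -- the old sets in `U`
  have hSold : ∀ m, ∀ y ∈ U, y ∈ S m ↔ Pm m (u y) (v y) := by
    intro m y hy
    rcases hT.eq_or m with h | h | h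
    · rw [h, hPi]; exact hT.mem_i y hy
    · rw [h, hPj]; exact hT.mem_j y hy
    · rw [h, hPl]; exact hT.mem_l y hy
  -- ### the modified sets and the new corner locus
  set S' : Fin 3 → Set X := fun m => {y | (y ∈ U ∧ Pm m (u' y) (v' y)) ∨ (y ∉ U ∧ y ∈ S m)} with hS'def
  set F' : Set X := {y | y ∈ U ∧ u' y = 0 ∧ v' y = 0} with hF'def
  have hS'U : ∀ m, ∀ y ∈ U, y ∈ S' m ↔ Pm m (u' y) (v' y) := fun m y hy =>
    mem_modifiedSet_iff_of_mem hy
  have hS'i : ∀ y ∈ U, y ∈ S' i ↔ 0 ≤ u' y ∧ 0 ≤ v' y := fun y hy => by rw [hS'U i y hy, hPi]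
  have hS'j : ∀ y ∈ U, y ∈ S' j ↔ u' y ≤ 0 ∧ u' y ≤ v' y := fun y hy => by rw [hS'U j y hy, hPj]
  have hS'l : ∀ y ∈ U, y ∈ S' l ↔ v' y ≤ 0 ∧ v' y ≤ u' y := fun y hy => by rw [hS'U l y hy, hPl]
  have hS'off : ∀ m, ∀ y ∉ KX, y ∈ S' m ↔ y ∈ S m := fun m y hy =>
    mem_modifiedSet_iff_of_not_mem (hSold m) hu'eq hv'eq hy
  have hPclosed : ∀ m, IsClosed {p : ℝ × ℝ | Pm m p.1 p.2} := by
    intro m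
    rcases hT.eq_or m with h | h | h <;> rw [h]
    · have : {p : ℝ × ℝ | Pm i p.1 p.2} = {p : ℝ × ℝ | 0 ≤ p.1 ∧ 0 ≤ p.2} := by
        ext p; exact hPi p.1 p.2
      rw [this]
      exact (isClosed_le continuous_const continuous_fst).inter (isClosed_le continuous_const continuous_snd)
    · have : {p : ℝ × ℝ | Pm j p.1 p.2} = {p : ℝ × ℝ | p.1 ≤ 0 ∧ p.1 ≤ p.2} := by
        ext p; exact hPj p.1 p.2
      rw [this]
      exact (isClosed_le continuous_fst continuous_const).inter (isClosed_le continuous_fst continuous_snd)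
    · have : {p : ℝ × ℝ | Pm l p.1 p.2} = {p : ℝ × ℝ | p.2 ≤ 0 ∧ p.2 ≤ p.1} := by
        ext p; exact hPl p.1 p.2
      rw [this]
      exact (isClosed_le continuous_snd continuous_const).inter (isClosed_le continuous_snd continuous_fst)
  have hS'c : ∀ m, IsCompact (S' m) := fun m =>
    isCompact_modifiedSet (hT.isCompact m) hKXc hKXU (hPclosed m) hfr.contMDiff_u.continuous
      hfr.contMDiff_v.continuous hu's.continuous hv's.continuous (hSold m) hu'eq hv'eq
  have hcover' : (⋃ m, S' m) = univ := iUnion_modifiedSet_eq_univ hcovP hT.cover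
  have hFU : (⋂ m, S m) ⊆ U := hfr.F_subset_U
  have hF'eq : (⋂ m, S' m) = F' := iInter_modifiedSet_eq hmeetP hFU
  have hF'U : F' ⊆ U := fun y hy => hy.1
  have hF'mem : ∀ y ∈ U, y ∈ F' ↔ u' y = 0 ∧ v' y = 0 := fun y hy =>
    ⟨fun h => h.2, fun h => ⟨hy, h⟩⟩
  have hF'c : IsCompact F' := isCompact_newCorner hfr.isCompact_F hFU hKXc hKXU hu's.continuous
    hv's.continuous hfr.memF_iff hu'eq hv'eq
  have hF'sub : F' ⊆ (⋂ m, S m) ∪ KX := newCorner_subset hfr.memF_iff hu'eq hv'eq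
  have hF'off : ∀ y ∉ KX, y ∈ F' ↔ y ∈ ⋂ m, S m := fun y hy =>
    mem_newCorner_iff_of_not_mem hFU hfr.memF_iff hu'eq hv'eq hy
  -- ### adapted charts along `F'` and the new product structure
  have hchart' : ∀ x' ∈ F', ∃ Ξ : OpenPartialHomeomorph X (EuclideanSpace ℝ (Fin 4)),
      Ξ ∈ IsManifold.maximalAtlas (𝓡 4) ∞ X ∧ x' ∈ Ξ.source ∧
      ∀ y ∈ Ξ.source, Ξ y 0 = u' y ∧ Ξ y 1 = v' y := by
    intro x' hx'
    by_cases hx'src : x' ∈ Θt.source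
    · obtain ⟨hu0, hv0⟩ := (hF'mem x' (hF'U hx')).1 hx'
      rw [hu'src x' hx'src] at hu0
      rw [hv'src x' hx'src] at hv0
      obtain ⟨Ψ, hzΨ, hΨs, hΨsymm, hΨ01⟩ := hΨ (Θt x') hu0 hv0
      refine ⟨Θt.trans Ψ, trans_mem_maximalAtlas hΘtmem (contDiffGroupoid_mem_of_contDiffOn_symm hΨs hΨsymm),
        ⟨hx'src, hzΨ⟩, fun y hy => ?_⟩
      obtain ⟨hysrc, hyΨ⟩ := hy
      have h := hΨ01 (Θt y) hyΨ
      simp only [OpenPartialHomeomorph.trans_apply]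
      rw [h.1, h.2, hu'src y hysrc, hv'src y hysrc]
      exact ⟨rfl, rfl⟩
    · have hx'K : x' ∉ KX := fun h => hx'src (hKXsrc h)
      have hx'F : x' ∈ ⋂ m, S m := (hF'off x' hx'K).1 hx'
      obtain ⟨C', hx'C', -⟩ := hT.sector_i.corner x' hx'F
      refine ⟨C'.Θ.restr KXᶜ, restr_mem_maximalAtlas _ C'.Θ_mem_maximalAtlas hKXc.isClosed.isOpen_compl,
        ?_, fun y hy => ?_⟩
      · rw [OpenPartialHomeomorph.restr_source, hKXc.isClosed.isOpen_compl.interior_eq]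
        exact ⟨hx'C', hx'K⟩
      · rw [OpenPartialHomeomorph.restr_source, hKXc.isClosed.isOpen_compl.interior_eq] at hy
        simp only [OpenPartialHomeomorph.restr_apply]
        rw [C'.apply_zero y hy.1, C'.apply_one y hy.1, hu'eq y hy.2, hv'eq y hy.2]
        exact ⟨rfl, rfl⟩
  obtain ⟨O', ρ', hO'o, hF'O', hO'U, hρ's, hρ'F', hρ'fix, hρ'O', hci'⟩ :=
    exists_cornerSliceChart_of_normalCoordinates hu's hv's hfr.isOpen_U hF'c hF'U hS'i hF'mem hchart'
  have hfr' : NormalFrame F' u' v' ρ' U O' :=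
    { isOpen_U := hfr.isOpen_U
      isOpen_O := hO'o
      isCompact_F := hF'c
      F_subset_O := hF'O'
      O_subset_U := hO'U
      contMDiff_u := hu's
      contMDiff_v := hv's
      contMDiff_ρ := hρ's
      memF_iff := hF'mem
      ρ_mem := hρ'F'
      ρ_eq_self := hρ'fix
      mapsTo_ρ := hρ'O' }
  -- corner-slice charts of the three new sectors
  have hcj' : ∀ x' ∈ F', ∃ C : CornerSliceChart (S' j) F' (fun y => v' y - u' y) (fun y => -u' y) ρ',
      x' ∈ C.Θ.source ∧ C.Θ.source ⊆ O' := by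
    intro x' hx'
    obtain ⟨Cn, hxCn, hCnO⟩ := hci' x' hx'
    refine ⟨Cn.relabelTriRot (fun q hq => hS'j q (hO'U (hCnO hq))), ?_, ?_⟩
    · rw [Cn.relabelTriRot_source]; exact hxCn
    · rw [Cn.relabelTriRot_source]; exact hCnO
  have hcl' : ∀ x' ∈ F', ∃ C : CornerSliceChart (S' l) F' (fun y => -v' y) (fun y => u' y - v' y) ρ',
      x' ∈ C.Θ.source ∧ C.Θ.source ⊆ O' := by
    intro x' hx'
    obtain ⟨Cn, hxCn, hCnO⟩ := hci' x' hx'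
    refine ⟨Cn.relabelTriRot₂ (fun q hq => hS'l q (hO'U (hCnO hq))), ?_, ?_⟩
    · rw [Cn.relabelTriRot₂_source]; exact hxCn
    · rw [Cn.relabelTriRot₂_source]; exact hCnO
  -- ### regularity of the new coordinates on the carrier
  have hreg_src : ∀ {w : X → ℝ} {g : EuclideanSpace ℝ (Fin 4) → ℝ}, ContMDiff (𝓡 4) 𝓘(ℝ, ℝ) ∞ w →
      (∀ y ∈ Θt.source, w y = g (Θt y)) → (∀ z, fderiv ℝ g z ≠ 0) →
      ∀ y ∈ KX, ¬ IsMCriticalPt (𝓡 4) w y := by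
    intro w g hws hwg hg y hyK hcr
    have hy : y ∈ Θt.source := hKXsrc hyK
    have heq : (w ∘ Θt.symm) =ᶠ[𝓝 (Θt y)] g := by
      filter_upwards [Θt.open_target.mem_nhds (Θt.map_source hy)] with z hz
      simp only [comp_apply, hwg _ (Θt.map_target hz), Θt.right_inv hz]
    have h1 := (morseData_of_comp_symm_eventuallyEq hΘtmem hws hy heq).1
    rw [h1, MorseBirth.isMCriticalPt_iff_fderiv] at hcr
    exact hg _ hcr
  have hduN' : ∀ z, fderiv ℝ uN z ≠ 0 := fun z h0 => by
    have := hduN z; rw [h0] at this; simp at this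
  have hdvN' : ∀ z, fderiv ℝ vN z ≠ 0 := fun z h0 => by
    have := hdvN z; rw [h0] at this; simp at this
  have hd3 : ∀ z : EuclideanSpace ℝ (Fin 4), fderiv ℝ (fun z : EuclideanSpace ℝ (Fin 4) => z 3) z ≠ 0 := by
    intro z h0
    have hd : HasFDerivAt (fun z : EuclideanSpace ℝ (Fin 4) => z 3)
        (EuclideanSpace.proj (3 : Fin 4) : EuclideanSpace ℝ (Fin 4) →L[ℝ] ℝ) z :=
      (EuclideanSpace.proj (3 : Fin 4) : EuclideanSpace ℝ (Fin 4) →L[ℝ] ℝ).hasFDerivAt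
    rw [hd.fderiv] at h0
    have := congrArg (fun L : EuclideanSpace ℝ (Fin 4) →L[ℝ] ℝ => L (EuclideanSpace.single 3 1)) h0
    simp at this
  have hdneg : ∀ {g : EuclideanSpace ℝ (Fin 4) → ℝ}, Differentiable ℝ g → (∀ z, fderiv ℝ g z ≠ 0) →
      ∀ z, fderiv ℝ (fun z => -g z) z ≠ 0 := by
    intro g hg hreg z h0
    have hd : HasFDerivAt (fun z => -g z) (-fderiv ℝ g z) z := (hg z).hasFDerivAt.neg
    rw [hd.fderiv, neg_eq_zero] at h0
    exact hreg z h0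
  have hvu : (fun z => vN z - uN z) = fun z : EuclideanSpace ℝ (Fin 4) => -z 3 := by
    funext z; have := hdiffN z; linarith
  have huv : (fun z => uN z - vN z) = fun z : EuclideanSpace ℝ (Fin 4) => z 3 := by
    funext z; exact hdiffN z
  have hdvu : ∀ z, fderiv ℝ (fun z => vN z - uN z) z ≠ 0 := by
    rw [hvu]; exact hdneg (by fun_prop) hd3
  have hduv : ∀ z, fderiv ℝ (fun z => uN z - vN z) z ≠ 0 := by rw [huv]; exact hd3
  have hdnu : ∀ z, fderiv ℝ (fun z => -uN z) z ≠ 0 := hdneg (huNs.differentiable (by simp)) hduN'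
  have hdnv : ∀ z, fderiv ℝ (fun z => -vN z) z ≠ 0 := hdneg (hvNs.differentiable (by simp)) hdvN'
  -- the coordinates of the three sectors through the chart
  have hu'src' : ∀ y ∈ Θt.source, u' y = uN (Θt y) := hu'src
  have hju'src : ∀ y ∈ Θt.source, (fun y => v' y - u' y) y = (fun z => vN z - uN z) (Θt y) :=
    fun y hy => by simp only [hu'src y hy, hv'src y hy]
  have hjv'src : ∀ y ∈ Θt.source, (fun y => -u' y) y = (fun z => -uN z) (Θt y) :=
    fun y hy => by simp only [hu'src y hy]
  have hlu'src : ∀ y ∈ Θt.source, (fun y => -v' y) y = (fun z => -vN z) (Θt y) :=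
    fun y hy => by simp only [hv'src y hy]
  have hlv'src : ∀ y ∈ Θt.source, (fun y => u' y - v' y) y = (fun z => uN z - vN z) (Θt y) :=
    fun y hy => by simp only [hu'src y hy, hv'src y hy]
  have hjusrc : ∀ y ∈ Θt.source, (fun y => v y - u y) y = (fun z : EuclideanSpace ℝ (Fin 4) => -z 3) (Θt y) :=
    fun y hy => by simp only [hu_src y hy, hv_src y hy]; ring
  have hjvsrc : ∀ y ∈ Θt.source, (fun y => -u y) y = (fun z : EuclideanSpace ℝ (Fin 4) => (z 0 - z 3) / 2) (Θt y) :=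
    fun y hy => by simp only [hu_src y hy]; ring
  have hlusrc : ∀ y ∈ Θt.source, (fun y => -v y) y = (fun z : EuclideanSpace ℝ (Fin 4) => (z 3 + z 0) / 2) (Θt y) :=
    fun y hy => by simp only [hv_src y hy]; ring
  have hlvsrc : ∀ y ∈ Θt.source, (fun y => u y - v y) y = (fun z : EuclideanSpace ℝ (Fin 4) => z 3) (Θt y) :=
    fun y hy => by simp only [hu_src y hy, hv_src y hy]; ring
  -- smoothness of the relabelled coordinates
  have hju's : ContMDiff (𝓡 4) 𝓘(ℝ, ℝ) ∞ fun y => v' y - u' y := hv's.sub hu's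
  have hjv's : ContMDiff (𝓡 4) 𝓘(ℝ, ℝ) ∞ fun y => -u' y := hu's.neg
  have hlu's : ContMDiff (𝓡 4) 𝓘(ℝ, ℝ) ∞ fun y => -v' y := hv's.neg
  have hlv's : ContMDiff (𝓡 4) 𝓘(ℝ, ℝ) ∞ fun y => u' y - v' y := hu's.sub hv's
  -- descriptions of the new sectors in the relabelled coordinates
  have hS'j' : ∀ y ∈ U, y ∈ S' j ↔ 0 ≤ v' y - u' y ∧ 0 ≤ -u' y := fun y hy => by
    rw [hS'j y hy]; constructor <;> intro h <;> constructor <;> linarith [h.1, h.2]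
  have hS'l' : ∀ y ∈ U, y ∈ S' l ↔ 0 ≤ -v' y ∧ 0 ≤ u' y - v' y := fun y hy => by
    rw [hS'l y hy]; constructor <;> intro h <;> constructor <;> linarith [h.1, h.2]
  have hF'j : ∀ y ∈ U, y ∈ F' ↔ v' y - u' y = 0 ∧ -u' y = 0 := fun y hy => by
    rw [hF'mem y hy]; constructor <;> intro h <;> constructor <;> linarith [h.1, h.2]
  have hF'l : ∀ y ∈ U, y ∈ F' ↔ -v' y = 0 ∧ u' y - v' y = 0 := fun y hy => by
    rw [hF'mem y hy]; constructor <;> intro h <;> constructor <;> linarith [h.1, h.2]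
  have hFnotint : ∀ m, ∀ x' ∈ ⋂ m, S m, x' ∉ interior (S m) := by
    intro m x' hx'
    rcases hT.eq_or m with h | h | h <;> rw [h]
    · exact hT.sector_i.not_mem_interior_of_mem_F hx'
    · exact hT.sector_j.not_mem_interior_of_mem_F hx'
    · exact hT.sector_l.not_mem_interior_of_mem_F hx'
  -- ### half-slice charts of the new sectors
  have hhalf'i := exists_halfSliceChart_of_implant hfr.isOpen_U hKXc hKXU hu's hv's hS'i hF'mem (hS'off i)
    hF'off hT.sector_i.half (hreg_src hu's hu'src hduN') (hreg_src hv's hv'src hdvN')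
  have hhalf'j := exists_halfSliceChart_of_implant hfr.isOpen_U hKXc hKXU hju's hjv's hS'j' hF'j (hS'off j)
    hF'off hT.sector_j.half (hreg_src hju's hju'src hdvu) (hreg_src hjv's hjv'src hdnu)
  have hhalf'l := exists_halfSliceChart_of_implant hfr.isOpen_U hKXc hKXU hlu's hlv's hS'l' hF'l (hS'off l)
    hF'off hT.sector_l.half (hreg_src hlu's hlu'src hdnv) (hreg_src hlv's hlv'src hduv)
  -- ### the raw presentations of the new sectors
  have hκi₀ : 0 < κi x := hκipos x (hFOκi hx)
  have hκj₀ : 0 < κj x := hκjpos x (hFOκj hx)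
  have hκl₀ : 0 < κl x := hκlpos x (hFOκl hx)
  have hxsT : ({xs} : Set (EuclideanSpace ℝ (Fin 4))) ⊆ Θt.target := by
    intro z hz; rw [mem_singleton_iff.1 hz]; exact hballT hxsball
  have hxsKb : xs ∈ Kb := Implant.mem_of_isMCriticalPt_quadrant hKbc.isClosed hout huxs hcritxs
  have hXsKXi : ∀ z ∈ ({xs} : Set (EuclideanSpace ℝ (Fin 4))), Θt.symm z ∈ KX := by
    intro z hz; rw [mem_singleton_iff.1 hz]; exact ⟨xs, hxsKb, rfl⟩
  have hXsi : ∀ z ∈ ({xs} : Set (EuclideanSpace ℝ (Fin 4))), 0 < uN z ∧ 0 < vN z ∧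
      IsMCriticalPt (𝓡 4) (fun z => -(uN z * vN z)) z ∧
      (mhessian (𝓡 4) (fun z => -(uN z * vN z)) z).Nondegenerate ∧
      morseIndex (𝓡 4) (fun z => -(uN z * vN z)) z = 1 := by
    intro z hz; rw [mem_singleton_iff.1 hz]; exact ⟨huxs, hvxs, hcritxs, hndxs, hidxxs⟩
  have hcriti : ∀ z ∈ Θt.target, Θt.symm z ∈ KX → 0 < uN z → 0 < vN z →
      IsMCriticalPt (𝓡 4) (fun z => -(uN z * vN z)) z → z ∈ ({xs} : Set (EuclideanSpace ℝ (Fin 4))) :=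
    fun z _ _ hu hv hcr => mem_singleton_iff.2 (huniq z hu hv hcr)
  obtain ⟨hinti, hGnis, hGnformi, hb1i', hi1i', hb2i', hi2i', hci'raw⟩ :=
    sector_rawPresentation_of_implant (am := fun z : EuclideanSpace ℝ (Fin 4) => (z 3 - z 0) / 2)
      (bm := fun z : EuclideanSpace ℝ (Fin 4) => (-z 3 - z 0) / 2) (aN := uN) (bN := vN)
      hΘtmem hfr.isOpen_U hsrcU hKXc hKXsrc (hT.isCompact i)
      hfr.contMDiff_u hfr.contMDiff_v hT.sector_i.interior_iff (hFnotint i) hGis hOκio hFOκi hGiform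
      hb1i hi1i hb2i hi2i hnocriti hci hBxio hKXBxi hBxiOκ hκiconst hκi₀ hu's hv's hS'i (hS'off i)
      hF'mem hF'off hu'eq hv'eq huNs hvNs hu_src hv_src hu'src hv'src hduN' hdvN' hf1 hf2
      (finite_singleton xs) hxsT hXsKXi hXsi hcriti
  have hXsj : ∀ z ∈ (∅ : Set (EuclideanSpace ℝ (Fin 4))), 0 < (fun z => vN z - uN z) z ∧ 0 < (fun z => -uN z) z ∧
      IsMCriticalPt (𝓡 4) (fun z => -((fun z => vN z - uN z) z * (fun z => -uN z) z)) z ∧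
      (mhessian (𝓡 4) (fun z => -((fun z => vN z - uN z) z * (fun z => -uN z) z)) z).Nondegenerate ∧
      morseIndex (𝓡 4) (fun z => -((fun z => vN z - uN z) z * (fun z => -uN z) z)) z = 1 :=
    fun z hz => absurd hz (notMem_empty z)
  have hcritj : ∀ z ∈ Θt.target, Θt.symm z ∈ KX → 0 < (fun z => vN z - uN z) z → 0 < (fun z => -uN z) z →
      IsMCriticalPt (𝓡 4) (fun z => -((fun z => vN z - uN z) z * (fun z => -uN z) z)) z →
      z ∈ (∅ : Set (EuclideanSpace ℝ (Fin 4))) :=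
    fun z _ _ hu hv hcr => absurd hcr (hnoj z hu hv)
  obtain ⟨hintj, hGnjs, hGnformj, hb1j', hi1j', hb2j', hi2j', hcj'raw⟩ :=
    sector_rawPresentation_of_implant (um := fun y => v y - u y) (vm := fun y => -u y)
      (un := fun y => v' y - u' y) (vn := fun y => -u' y)
      (am := fun z : EuclideanSpace ℝ (Fin 4) => -z 3)
      (bm := fun z : EuclideanSpace ℝ (Fin 4) => (z 0 - z 3) / 2) (aN := fun z => vN z - uN z)
      (bN := fun z => -uN z) (Xs := ∅)
      hΘtmem hfr.isOpen_U hsrcU hKXc hKXsrc (hT.isCompact j)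
      (hfr.contMDiff_v.sub hfr.contMDiff_u) hfr.contMDiff_u.neg hT.sector_j.interior_iff (hFnotint j)
      hGjs hOκjo hFOκj hGjform hb1j hi1j hb2j hi2j hnocritj hcj hBxjo hKXBxj hBxjOκ hκjconst hκj₀
      hju's hjv's hS'j' (hS'off j) hF'j hF'off
      (fun y hy => by simp only [hu'eq y hy, hv'eq y hy]) (fun y hy => by simp only [hu'eq y hy])
      (hvNs.sub huNs) huNs.neg hjusrc hjvsrc hju'src hjv'src hdvu hdnu hf3 hf4
      finite_empty (empty_subset _) (fun z hz => absurd hz (notMem_empty z)) hXsj hcritj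
  have hXsl : ∀ z ∈ (∅ : Set (EuclideanSpace ℝ (Fin 4))), 0 < (fun z => -vN z) z ∧ 0 < (fun z => uN z - vN z) z ∧
      IsMCriticalPt (𝓡 4) (fun z => -((fun z => -vN z) z * (fun z => uN z - vN z) z)) z ∧
      (mhessian (𝓡 4) (fun z => -((fun z => -vN z) z * (fun z => uN z - vN z) z)) z).Nondegenerate ∧
      morseIndex (𝓡 4) (fun z => -((fun z => -vN z) z * (fun z => uN z - vN z) z)) z = 1 :=
    fun z hz => absurd hz (notMem_empty z)
  have hcritl : ∀ z ∈ Θt.target, Θt.symm z ∈ KX → 0 < (fun z => -vN z) z → 0 < (fun z => uN z - vN z) z →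
      IsMCriticalPt (𝓡 4) (fun z => -((fun z => -vN z) z * (fun z => uN z - vN z) z)) z →
      z ∈ (∅ : Set (EuclideanSpace ℝ (Fin 4))) :=
    fun z _ _ hu hv hcr => absurd hcr (hnol z hu hv)
  obtain ⟨hintl, hGnls, hGnforml, hb1l', hi1l', hb2l', hi2l', hcl'raw⟩ :=
    sector_rawPresentation_of_implant (um := fun y => -v y) (vm := fun y => u y - v y)
      (un := fun y => -v' y) (vn := fun y => u' y - v' y)
      (am := fun z : EuclideanSpace ℝ (Fin 4) => (z 3 + z 0) / 2)
      (bm := fun z : EuclideanSpace ℝ (Fin 4) => z 3) (aN := fun z => -vN z)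
      (bN := fun z => uN z - vN z) (Xs := ∅)
      hΘtmem hfr.isOpen_U hsrcU hKXc hKXsrc (hT.isCompact l)
      hfr.contMDiff_v.neg (hfr.contMDiff_u.sub hfr.contMDiff_v) hT.sector_l.interior_iff (hFnotint l)
      hGls hOκlo hFOκl hGlform hb1l hi1l hb2l hi2l hnocritl hcl hBxlo hKXBxl hBxlOκ hκlconst hκl₀
      hlu's hlv's hS'l' (hS'off l) hF'l hF'off
      (fun y hy => by simp only [hv'eq y hy]) (fun y hy => by simp only [hu'eq y hy, hv'eq y hy])
      hvNs.neg (huNs.sub hvNs) hlusrc hlvsrc hlu'src hlv'src hdnv hduv hf5 hf6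
      finite_empty (empty_subset _) (fun z hz => absurd hz (notMem_empty z)) hXsl hcritl
  -- ### renormalising to the new retraction
  have hF'Oκ : ∀ {Oκm Bxm : Set X}, (⋂ m, S m) ⊆ Oκm → KX ⊆ Bxm → Bxm ⊆ Oκm →
      F' ⊆ Oκm ∩ (KXᶜ ∪ Bxm) ∩ O' := by
    intro Oκm Bxm hFO hKB hBO y hy
    refine ⟨⟨?_, ?_⟩, hF'O' hy⟩
    · rcases hF'sub hy with h | h
      · exact hFO h
      · exact hBO (hKB h)
    · by_cases hyK : y ∈ KX
      · exact Or.inr (hKB hyK)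
      · exact Or.inl hyK
  have hopen3 : ∀ {Oκm Bxm : Set X}, IsOpen Oκm → IsOpen Bxm → IsOpen (Oκm ∩ (KXᶜ ∪ Bxm) ∩ O') :=
    fun hO hB => (hO.inter (hKXc.isClosed.isOpen_compl.union hB)).inter hO'o
  set c' : Fin 3 → ℕ → ℕ := Function.update c i (fun n => c i n + if n = 1 then 1 else 0) with hc'def
  have hc'i : ∀ n, (interior (S' i) ∩ criticalSetOfIndex (𝓡 4)
      (fun y => Gi y + 2 * κi x * (u y * v y - u' y * v' y)) n).ncard = c' i n := by
    intro n
    rw [hci'raw n, hc'def, Function.update_self]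
    simp
  have hc'j : ∀ n, (interior (S' j) ∩ criticalSetOfIndex (𝓡 4)
      (fun y => Gj y + 2 * κj x * ((fun y => v y - u y) y * (fun y => -u y) y -
        (fun y => v' y - u' y) y * (fun y => -u' y) y)) n).ncard = c' j n := by
    intro n
    rw [hcj'raw n, hc'def, Function.update_of_ne (Ne.symm hij)]
    simp
  have hc'l : ∀ n, (interior (S' l) ∩ criticalSetOfIndex (𝓡 4)
      (fun y => Gl y + 2 * κl x * ((fun y => -v y) y * (fun y => u y - v y) y -
        (fun y => -v' y) y * (fun y => u' y - v' y) y)) n).ncard = c' l n := by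
    intro n
    rw [hcl'raw n, hc'def, Function.update_of_ne (Ne.symm hil)]
    simp
  have hSi' : SectorNormalForm (S' i) F' u' v' ρ' U O' (c' i) :=
    sectorNormalForm_of_rawPresentation hfr' (hS'c i) hS'i hinti hci' hhalf'i hGnis hκis
      (hopen3 hOκio hBxio) (hF'Oκ hFOκi hKXBxi hBxiOκ) (fun y hy => hy.2)
      (fun y hy => hκipos y hy.1.1) (fun y hy => hGnformi y hy.1) hb1i' hi1i' hb2i' hi2i' hc'i
  have hSj' : SectorNormalForm (S' j) F' (fun y => v' y - u' y) (fun y => -u' y) ρ' U O' (c' j) :=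
    sectorNormalForm_of_rawPresentation hfr'.relabelTriRot (hS'c j) hS'j' hintj hcj' hhalf'j hGnjs hκjs
      (hopen3 hOκjo hBxjo) (hF'Oκ hFOκj hKXBxj hBxjOκ) (fun y hy => hy.2)
      (fun y hy => hκjpos y hy.1.1) (fun y hy => hGnformj y hy.1) hb1j' hi1j' hb2j' hi2j' hc'j
  have hSl' : SectorNormalForm (S' l) F' (fun y => -v' y) (fun y => u' y - v' y) ρ' U O' (c' l) :=
    sectorNormalForm_of_rawPresentation hfr'.relabelTriRot₂ (hS'c l) hS'l' hintl hcl' hhalf'l hGnls hκls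
      (hopen3 hOκlo hBxlo) (hF'Oκ hFOκl hKXBxl hBxlOκ) (fun y hy => hy.2)
      (fun y hy => hκlpos y hy.1.1) (fun y hy => hGnforml y hy.1) hb1l' hi1l' hb2l' hi2l' hc'l
  -- ### disjointness of the new sectors
  have hint'U : ∀ m, ∀ y ∈ U, y ∈ interior (S' m) →
      (m = i → 0 < u' y ∧ 0 < v' y) ∧ (m = j → 0 < v' y - u' y ∧ 0 < -u' y) ∧
      (m = l → 0 < -v' y ∧ 0 < u' y - v' y) := by
    intro m y hyU hyint
    refine ⟨?_, ?_, ?_⟩ <;> rintro rfl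
    · exact (hinti y hyU (interior_subset hyint)).1 hyint
    · exact (hintj y hyU (interior_subset hyint)).1 hyint
    · exact (hintl y hyU (interior_subset hyint)).1 hyint
  have hdisj' : ∀ m m', m ≠ m' → Disjoint (interior (S' m)) (S' m') := by
    intro m m' hmm'
    rw [Set.disjoint_left]
    intro y hyint hym'
    by_cases hyU : y ∈ U
    · have hstr := hint'U m y hyU hyint
      have hmem' := (hS'U m' y hyU).1 hym'
      rcases hT.eq_or m with rfl | rfl | rfl <;> rcases hT.eq_or m' with rfl | rfl | rfl
      · exact hmm' rfl
      · have h1 := hstr.1 rfl; have h2 := (hPj _ _).1 hmem'; linarith [h1.1, h2.1]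
      · have h1 := hstr.1 rfl; have h2 := (hPl _ _).1 hmem'; linarith [h1.2, h2.1]
      · have h1 := hstr.2.1 rfl; have h2 := (hPi _ _).1 hmem'; linarith [h1.2, h2.1]
      · exact hmm' rfl
      · have h1 := hstr.2.1 rfl; have h2 := (hPl _ _).1 hmem'; linarith [h1.1, h2.2]
      · have h1 := hstr.2.2 rfl; have h2 := (hPi _ _).1 hmem'; linarith [h1.1, h2.2]
      · have h1 := hstr.2.2 rfl; have h2 := (hPj _ _).1 hmem'; linarith [h1.2, h2.2]
      · exact hmm' rfl
    · have hyK : y ∉ KX := fun h => hyU (hKXU h)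
      have hS'eq : ∀ m, S' m ∩ KXᶜ = S m ∩ KXᶜ := by
        intro m; ext z; constructor
        · rintro ⟨h1, h2⟩; exact ⟨(hS'off m z h2).1 h1, h2⟩
        · rintro ⟨h1, h2⟩; exact ⟨(hS'off m z h2).2 h1, h2⟩
      have hyintS : y ∈ interior (S m) :=
        (mem_interior_iff_of_inter_eq hKXc.isClosed.isOpen_compl (hS'eq m) hyK).1 hyint
      have hymS : y ∈ S m' := (hS'off m' y hyK).1 hym'
      exact Set.disjoint_left.1 (hT.disjoint m m' hmm') hyintS hymS
  -- ### the new trisection in normal form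
  have hagreeS : ∀ m, ∀ y ∉ Ω, y ∈ S' m ↔ y ∈ S m := fun m y hy =>
    hS'off m y (fun h => hy (hΩ'Ω (hKXΩ' h)))
  have hagreeuv : ∀ y ∉ Ω, u' y = u y ∧ v' y = v y := fun y hy =>
    ⟨hu'eq y (fun h => hy (hΩ'Ω (hKXΩ' h))), hv'eq y (fun h => hy (hΩ'Ω (hKXΩ' h)))⟩
  have hTn : TriNormalForm S' i j l u' v' ρ' U O' (Function.update c i (fun n => c i n + if n = 1 then 1 else 0)) := by
    have hfr'' := hfr'
    have hSi'' := hSi'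
    have hSj'' := hSj'
    have hSl'' := hSl'
    rw [← hF'eq] at hfr'' hSi'' hSj'' hSl''
    exact
      { ne_ij := hij
        ne_jl := hjl
        ne_il := hil
        cover := hcover'
        frame := hfr''
        mem_j := hS'j
        mem_l := hS'l
        sector_i := hSi''
        sector_j := hSj''
        sector_l := hSl''
        disjoint := hdisj' }
  -- ### common facts for the faces
  have hF'offF : ∀ y ∉ KX, y ∈ F' ↔ y ∈ ⋂ m, S m := hF'off
  have hNs : ContDiff ℝ ∞ N := contMDiff_iff_contDiff.1 hNmorse.1
  have hKX_Kb : ∀ y ∈ KX, Θt y ∈ Kb := by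
    rintro _ ⟨z, hz, rfl⟩; rw [Θt.right_inv (hKbT hz)]; exact hz
  have hz₀K : z₀ ∈ K := Implant.mem_of_isMCriticalPt_of_eq_coord hKc.isClosed hNK
    (by rw [← mem_criticalSet (I := 𝓡 3), hNcrit]; exact mem_insert _ _)
  have hz₁K : z₁ ∈ K := Implant.mem_of_isMCriticalPt_of_eq_coord hKc.isClosed hNK
    (by rw [← mem_criticalSet (I := 𝓡 3), hNcrit]; exact mem_insert_of_mem _ rfl)
  have hNsmall : ∀ z ∈ K, |N z| < P₀ := by
    intro z hz
    have h := hsmallN (snocEquiv 3 (z, 0)) (by rw [dropLast_snocEquiv]; exact hz)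
    rw [dropLast_snocEquiv] at h
    have h0 : (snocEquiv 3 (z, (0:ℝ))) 0 = z 0 := snocEquiv_apply_zero 3 (z, 0)
    rw [h0] at h
    calc |N z| = |(N z - z 0) + z 0| := by ring_nf
      _ ≤ |N z - z 0| + |z 0| := abs_add_le _ _
      _ < P₀ := by linarith
  have hcritN_mem : ∀ z, IsMCriticalPt (𝓡 3) N z → z = z₀ ∨ z = z₁ := by
    intro z hz
    have : z ∈ criticalSet (𝓡 3) N := hz
    rw [hNcrit] at this
    simpa using this
  have hlast3 : ∀ (p : EuclideanSpace ℝ (Fin 3)) (t : ℝ), snocEquiv 3 (p, t) 3 = t := fun p t =>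
    snocEquiv_apply_last 3 (p, t)
  -- graph points over `K` with `|x₃| ≤ 3P₀/2` are in `KX`
  have hgraph_KX : ∀ (z : EuclideanSpace ℝ (Fin 3)) (t : ℝ), z ∈ K → |t| ≤ 3 / 2 * P₀ →
      snocEquiv 3 (z, t) ∈ Kb ∧ snocEquiv 3 (z, t) ∈ Θt.target ∧ Θt.symm (snocEquiv 3 (z, t)) ∈ KX := by
    intro z t hz ht
    have hmem : snocEquiv 3 (z, t) ∈ Kb := ⟨by rw [hlast3]; exact ht, by rw [dropLast_snocEquiv]; exact hz⟩
    exact ⟨hmem, hKbT hmem, ⟨_, hmem, rfl⟩⟩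
  -- the old faces have no critical points over `KX`
  have hKXOij : KX ⊆ Oij := fun y hy => (hKXΩ' hy).2.1.1.2
  have hKXOjl : KX ⊆ Ojl := fun y hy => (hKXΩ' hy).2.1.2.2
  have hKXOli : KX ⊆ Oli := fun y hy => (hKXΩ' hy).2.2.2
  have hKXBxij : KX ⊆ Bxij := fun y hy => (hKXΩ' hy).2.1.1.1
  have hKXBxjl : KX ⊆ Bxjl := fun y hy => (hKXΩ' hy).2.1.2.1
  have hKXBxli : KX ⊆ Bxli := fun y hy => (hKXΩ' hy).2.2.1
  -- ### the face `(i, j)`: the graph `x₃ = N`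
  have hQnU_ij : ∀ y ∈ U, y ∈ S' i ∩ S' j ↔ u' y = 0 ∧ 0 ≤ v' y := by
    intro y hy
    rw [mem_inter_iff, hS'i y hy, hS'j y hy]
    constructor
    · rintro ⟨⟨h1, h2⟩, h3, -⟩; exact ⟨le_antisymm h3 h1, h2⟩
    · rintro ⟨h1, h2⟩; exact ⟨⟨h1.ge, h2⟩, h1.le, by rw [h1]; exact h2⟩
  have hQnQ_ij : ∀ y ∉ KX, y ∈ S' i ∩ S' j ↔ y ∈ S i ∩ S j := fun y hy => by
    rw [mem_inter_iff, mem_inter_iff, hS'off i y hy, hS'off j y hy]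
  set Vij : Set X := Θt.source ∩ Θt ⁻¹' {z | |z 3| < P₀ ∧ 0 < vN z} ∩ Bxij with hVij
  have hVijo : IsOpen Vij := by
    refine (Θt.continuousOn.isOpen_inter_preimage Θt.open_source ?_).inter hBxijo
    exact (isOpen_lt (continuous_abs.comp (EuclideanSpace.proj (3 : Fin 4)).continuous) continuous_const).inter
      (isOpen_lt continuous_const hvNs.continuous)
  have hVijsrc : Vij ⊆ Θt.source := fun y hy => hy.1.1
  have hgraph_ij : ∀ q ∈ Vij, q ∈ S' i ∩ S' j ↔ Θt q 3 = N (dropLast 2 (Θt q)) := by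
    rintro q ⟨⟨hqsrc, hq3, hqv⟩, -⟩
    have hqU : q ∈ U := hsrcU hqsrc
    rw [hQnU_ij q hqU, hu'src q hqsrc, hv'src q hqsrc, (hslab (Θt q) hq3.le).1]
    constructor
    · rintro ⟨h1, -⟩; linarith
    · intro h; exact ⟨by rw [h]; ring, hqv.le⟩
  have hKXV_ij : ∀ y ∈ S' i ∩ S' j, y ∈ KX → y ∉ F' → y ∈ Vij := by
    intro y hyQ hyK hyF
    have hysrc : y ∈ Θt.source := hKXsrc hyK
    have hyU : y ∈ U := hKXU hyK
    obtain ⟨hu0, hv0⟩ := (hQnU_ij y hyU).1 hyQ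
    have hvpos : 0 < v' y := lt_of_le_of_ne hv0 fun h0 => hyF ((hF'mem y hyU).2 ⟨hu0, h0.symm⟩)
    have huN0 : uN (Θt y) = 0 := by rw [← hu'src y hysrc]; exact hu0
    have h3 : |Θt y 3| < P₀ := hfaces (Θt y) (Or.inl huN0) (hKX_Kb y hyK).2
    exact ⟨⟨hysrc, h3, by rw [← hv'src y hysrc]; exact hvpos⟩, hKXBxij hyK⟩
  have hlam0ij : 0 < lamij x := hlamijpos x (hFOlij hx)
  have hGNgraph_ij : ∀ q ∈ Vij, q ∈ S' i ∩ S' j →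
      Gij q + lamij x * (v q - v' q) = 1 + lamij x * N (dropLast 2 (Θt q)) := by
    rintro q ⟨⟨hqsrc, hq3, hqv⟩, hqB⟩ hqQ
    have hq3eq : Θt q 3 = N (dropLast 2 (Θt q)) := (hgraph_ij q ⟨⟨hqsrc, hq3, hqv⟩, hqB⟩).1 hqQ
    rw [hGijform q (hBxijOl hqB), hlamijconst q hqB, hv'src q hqsrc, (hslab (Θt q) hq3.le).2, hq3eq]
    ring
  -- the new critical point of the face
  set qij : X := Θt.symm (snocEquiv 3 (z₀, N z₀)) with hqij
  have hqij_facts : qij ∈ S' i ∩ S' j ∧ qij ∈ KX ∧ qij ∉ F' ∧ dropLast 2 (Θt qij) = z₀ := by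
    obtain ⟨hKb, hT, hKX⟩ := hgraph_KX z₀ (N z₀) hz₀K ((hNsmall z₀ hz₀K).le.trans (by linarith))
    have hΘq : Θt qij = snocEquiv 3 (z₀, N z₀) := Θt.right_inv hT
    have hsrc : qij ∈ Θt.source := hKXsrc hKX
    have hU : qij ∈ U := hKXU hKX
    have h3 : |snocEquiv 3 (z₀, N z₀) 3| ≤ P₀ := by rw [hlast3]; exact (hNsmall z₀ hz₀K).le
    have hu0 : u' qij = 0 := by
      rw [hu'src qij hsrc, hΘq, (hslab _ h3).1, hlast3, dropLast_snocEquiv]; ring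
    have hv0 : v' qij = -N z₀ := by
      rw [hv'src qij hsrc, hΘq, (hslab _ h3).2, hlast3, dropLast_snocEquiv]; ring
    refine ⟨(hQnU_ij qij hU).2 ⟨hu0, by rw [hv0]; linarith⟩, hKX, fun hF => ?_, by rw [hΘq, dropLast_snocEquiv]⟩
    have := ((hF'mem qij hU).1 hF).2
    rw [hv0] at this; linarith
  set NCij : Set X := {q | q ∈ S' i ∩ S' j ∧ q ∈ KX ∧ q ∉ F' ∧ IsMCriticalPt (𝓡 3) N (dropLast 2 (Θt q))} with hNCij
  have hNCij_eq : NCij = {qij} := by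
    ext q
    simp only [hNCij, mem_setOf_eq, mem_singleton_iff]
    constructor
    · rintro ⟨hqQ, hqK, hqF, hqcrit⟩
      have hqV := hKXV_ij q hqQ hqK hqF
      have hq3 : Θt q 3 = N (dropLast 2 (Θt q)) := (hgraph_ij q hqV).1 hqQ
      have hvpos : 0 < vN (Θt q) := hqV.1.2.2
      rcases hcritN_mem _ hqcrit with hz | hz
      · -- `q = Θt.symm (z₀, N z₀)`
        have hΘq : Θt q = snocEquiv 3 (z₀, N z₀) := by
          rw [← hz, ← hq3]
          have h1 : (dropLast 2 (Θt q), Θt q (Fin.last 3)) = (snocEquiv 3).symm (Θt q) :=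
            Prod.ext (by rw [dropLast_apply]) (by rw [snocEquiv_symm_apply_snd])
          show Θt q = snocEquiv 3 (dropLast 2 (Θt q), Θt q (Fin.last 3))
          rw [h1, ContinuousLinearEquiv.apply_symm_apply]
        rw [hqij, ← hΘq, Θt.left_inv (hKXsrc hqK)]
      · exfalso
        have h3' : |Θt q 3| ≤ P₀ := hqV.1.2.1.le
        have := (hslab (Θt q) h3').2
        rw [this, hq3, hz] at hvpos
        linarith
    · rintro rfl
      obtain ⟨h1, h2, h3, h4⟩ := hqij_facts
      refine ⟨h1, h2, h3, ?_⟩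
      rw [h4]; show z₀ ∈ criticalSet (𝓡 3) N; rw [hNcrit]; exact mem_insert _ _
  have hNCij_fin : NCij.Finite := by rw [hNCij_eq]; exact finite_singleton _
  have hNCij_card : NCij.ncard = 1 := by rw [hNCij_eq, ncard_singleton]
  have hnocritKX_ij : letI := Φij.chartedSpace
      ∀ p : ↥(S i ∩ S j), p.1 ∈ KX → ¬ IsMCriticalPt (𝓡∂ 3) (Gij ∘ Subtype.val : ↥(S i ∩ S j) → ℝ) p :=
    fun p hp => hnocOij p (hKXOij hp)
  have hcfin_ij : letI := Φij.chartedSpace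
      (criticalSet (𝓡∂ 3) (Gij ∘ Subtype.val : ↥(S i ∩ S j) → ℝ)).Finite :=
    finite_criticalSet_face ((hT.isCompact i).inter (hT.isCompact j)) Φij hGijs fun p hp => (hcritij p hp).2
  have hcornerN_ij : ∀ x' ∈ F', ∃ C : CornerSliceChart (S' i) F' u' v' ρ', x' ∈ C.Θ.source ∧ C.Θ.source ⊆ U := by
    intro x' hx'
    obtain ⟨Cn, hxCn, hCnO⟩ := hci' x' hx'
    exact ⟨Cn, hxCn, hCnO.trans hO'U⟩
  have hFij : FaceNormalForm (S' i ∩ S' j) F' u' v' U (fun n => cf₁ n + if n = 1 then NCij.ncard else 0) :=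
    face_of_implant hΘtmem hfr.isOpen_U hKXc hKXU hfr.contMDiff_v Φij hdetij hGijs hlamijs hOlijo hFOlij
      hOlijU hlamijpos hGijform hGijlt hcritij hcountij hcfin_ij hBxijo hKXBxij hBxijOl hlamijconst hlam0ij
      hnocritKX_ij hv's hu's ((hS'c i).inter (hS'c j))
      (by rw [← hF'eq]; exact fun y hy => ⟨mem_iInter.1 hy i, mem_iInter.1 hy j⟩) hF'U hQnU_ij hF'mem
      hQnQ_ij hF'offF hv'eq hcornerN_ij hVijo hVijsrc hKXV_ij hNs hNs hgraph_ij hlam0ij.ne' hGNgraph_ij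
      (NewCrit := NCij) (fun q => Iff.rfl) hNCij_fin
      (fun q hq => by
        rw [hNCij_eq, mem_singleton_iff] at hq
        subst hq
        rw [hqij_facts.2.2.2]
        refine ⟨hNmorse.2 z₀ (by show z₀ ∈ criticalSet (𝓡 3) N; rw [hNcrit]; exact mem_insert _ _),
          fun _ => hiz₀, fun h => absurd h (not_lt.2 hlam0ij.le)⟩)
  rw [hNCij_card] at hFij
  -- ### the face `(l, i)`: the graph `x₃ = -N`
  have hQnU_li : ∀ y ∈ U, y ∈ S' l ∩ S' i ↔ -v' y = 0 ∧ 0 ≤ u' y - v' y := by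
    intro y hy
    rw [mem_inter_iff, hS'l y hy, hS'i y hy]
    constructor
    · rintro ⟨⟨h1, h2⟩, h3, h4⟩; constructor <;> linarith
    · rintro ⟨h1, h2⟩; refine ⟨⟨?_, ?_⟩, ?_, ?_⟩ <;> linarith
  have hQnQ_li : ∀ y ∉ KX, y ∈ S' l ∩ S' i ↔ y ∈ S l ∩ S i := fun y hy => by
    rw [mem_inter_iff, mem_inter_iff, hS'off l y hy, hS'off i y hy]
  set Vli : Set X := Θt.source ∩ Θt ⁻¹' {z | |z 3| < P₀ ∧ 0 < z 3} ∩ Bxli with hVli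
  have hVlio : IsOpen Vli := by
    refine (Θt.continuousOn.isOpen_inter_preimage Θt.open_source ?_).inter hBxlio
    exact (isOpen_lt (continuous_abs.comp (EuclideanSpace.proj (3 : Fin 4)).continuous) continuous_const).inter
      (isOpen_lt continuous_const (EuclideanSpace.proj (3 : Fin 4)).continuous)
  have hVlisrc : Vli ⊆ Θt.source := fun y hy => hy.1.1
  have hgraph_li : ∀ q ∈ Vli, q ∈ S' l ∩ S' i ↔ Θt q 3 = (fun z => -N z) (dropLast 2 (Θt q)) := by
    rintro q ⟨⟨hqsrc, hq3, hqv⟩, -⟩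
    have hqU : q ∈ U := hsrcU hqsrc
    rw [hQnU_li q hqU, hu'src q hqsrc, hv'src q hqsrc, (hslab (Θt q) hq3.le).1, (hslab (Θt q) hq3.le).2]
    have hqv' : 0 < Θt q 3 := hqv
    constructor
    · rintro ⟨h1, -⟩; simp only at h1 ⊢; linarith
    · intro h; simp only at h; constructor <;> linarith
  have hKXV_li : ∀ y ∈ S' l ∩ S' i, y ∈ KX → y ∉ F' → y ∈ Vli := by
    intro y hyQ hyK hyF
    have hysrc : y ∈ Θt.source := hKXsrc hyK
    have hyU : y ∈ U := hKXU hyK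
    obtain ⟨hv0, huv⟩ := (hQnU_li y hyU).1 hyQ
    have hv0' : v' y = 0 := by linarith
    have hpos : 0 < u' y - v' y := lt_of_le_of_ne huv fun h0 => hyF ((hF'mem y hyU).2 ⟨by linarith, hv0'⟩)
    have hvN0 : vN (Θt y) = 0 := by rw [← hv'src y hysrc]; exact hv0'
    have h3 : |Θt y 3| < P₀ := hfaces (Θt y) (Or.inr hvN0) (hKX_Kb y hyK).2
    have h3pos : 0 < Θt y 3 := by
      rw [← hdiffN (Θt y), ← hu'src y hysrc, ← hv'src y hysrc]; exact hpos
    exact ⟨⟨hysrc, h3, h3pos⟩, hKXBxli hyK⟩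
  have hlam0li : 0 < lamli x := hlamlipos x (hFOlli hx)
  have hGNgraph_li : ∀ q ∈ Vli, q ∈ S' l ∩ S' i →
      Gli q + lamli x * ((fun y => u y - v y) q - (fun y => u' y - v' y) q) = 1 + lamli x * N (dropLast 2 (Θt q)) := by
    rintro q ⟨⟨hqsrc, hq3, hqv⟩, hqB⟩ hqQ
    have hq3eq : Θt q 3 = -N (dropLast 2 (Θt q)) := (hgraph_li q ⟨⟨hqsrc, hq3, hqv⟩, hqB⟩).1 hqQ
    simp only
    rw [hGliform q (hBxliOl hqB), hlamliconst q hqB, hu'src q hqsrc, hv'src q hqsrc, hdiffN (Θt q), hq3eq]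
    ring
  set qli : X := Θt.symm (snocEquiv 3 (z₀, -N z₀)) with hqli
  have hqli_facts : qli ∈ S' l ∩ S' i ∧ qli ∈ KX ∧ qli ∉ F' ∧ dropLast 2 (Θt qli) = z₀ := by
    obtain ⟨hKb, hT, hKX⟩ := hgraph_KX z₀ (-N z₀) hz₀K (by rw [abs_neg]; exact (hNsmall z₀ hz₀K).le.trans (by linarith))
    have hΘq : Θt qli = snocEquiv 3 (z₀, -N z₀) := Θt.right_inv hT
    have hsrc : qli ∈ Θt.source := hKXsrc hKX
    have hU : qli ∈ U := hKXU hKX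
    have h3 : |snocEquiv 3 (z₀, -N z₀) 3| ≤ P₀ := by rw [hlast3, abs_neg]; exact (hNsmall z₀ hz₀K).le
    have hu0 : u' qli = -N z₀ := by
      rw [hu'src qli hsrc, hΘq, (hslab _ h3).1, hlast3, dropLast_snocEquiv]; ring
    have hv0 : v' qli = 0 := by
      rw [hv'src qli hsrc, hΘq, (hslab _ h3).2, hlast3, dropLast_snocEquiv]; ring
    refine ⟨(hQnU_li qli hU).2 ⟨by rw [hv0]; ring, by rw [hu0, hv0]; linarith⟩, hKX, fun hF => ?_,
      by rw [hΘq, dropLast_snocEquiv]⟩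
    have := ((hF'mem qli hU).1 hF).1
    rw [hu0] at this; linarith
  set NCli : Set X := {q | q ∈ S' l ∩ S' i ∧ q ∈ KX ∧ q ∉ F' ∧ IsMCriticalPt (𝓡 3) N (dropLast 2 (Θt q))} with hNCli
  have hNCli_eq : NCli = {qli} := by
    ext q
    simp only [hNCli, mem_setOf_eq, mem_singleton_iff]
    constructor
    · rintro ⟨hqQ, hqK, hqF, hqcrit⟩
      have hqV := hKXV_li q hqQ hqK hqF
      have hq3 : Θt q 3 = -N (dropLast 2 (Θt q)) := (hgraph_li q hqV).1 hqQ
      have hpos : 0 < Θt q 3 := hqV.1.2.2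
      rcases hcritN_mem _ hqcrit with hz | hz
      · have hΘq : Θt q = snocEquiv 3 (z₀, -N z₀) := by
          rw [← hz, ← hq3]
          have h1 : (dropLast 2 (Θt q), Θt q (Fin.last 3)) = (snocEquiv 3).symm (Θt q) :=
            Prod.ext (by rw [dropLast_apply]) (by rw [snocEquiv_symm_apply_snd])
          show Θt q = snocEquiv 3 (dropLast 2 (Θt q), Θt q (Fin.last 3))
          rw [h1, ContinuousLinearEquiv.apply_symm_apply]
        rw [hqli, ← hΘq, Θt.left_inv (hKXsrc hqK)]
      · exfalso
        rw [hq3, hz] at hpos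
        linarith
    · rintro rfl
      obtain ⟨h1, h2, h3, h4⟩ := hqli_facts
      refine ⟨h1, h2, h3, ?_⟩
      rw [h4]; show z₀ ∈ criticalSet (𝓡 3) N; rw [hNcrit]; exact mem_insert _ _
  have hNCli_fin : NCli.Finite := by rw [hNCli_eq]; exact finite_singleton _
  have hNCli_card : NCli.ncard = 1 := by rw [hNCli_eq, ncard_singleton]
  have hnocritKX_li : letI := Φli.chartedSpace
      ∀ p : ↥(S l ∩ S i), p.1 ∈ KX → ¬ IsMCriticalPt (𝓡∂ 3) (Gli ∘ Subtype.val : ↥(S l ∩ S i) → ℝ) p :=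
    fun p hp => hnocOli p (hKXOli hp)
  have hcfin_li : letI := Φli.chartedSpace
      (criticalSet (𝓡∂ 3) (Gli ∘ Subtype.val : ↥(S l ∩ S i) → ℝ)).Finite :=
    finite_criticalSet_face ((hT.isCompact l).inter (hT.isCompact i)) Φli hGlis fun p hp => (hcritli p hp).2
  have hcornerN_li : ∀ x' ∈ F', ∃ C : CornerSliceChart (S' l) F' (fun y => -v' y) (fun y => u' y - v' y) ρ',
      x' ∈ C.Θ.source ∧ C.Θ.source ⊆ U := by
    intro x' hx'
    obtain ⟨Cn, hxCn, hCnO⟩ := hcl' x' hx'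
    exact ⟨Cn, hxCn, hCnO.trans hO'U⟩
  have hF'li : ∀ y ∈ U, y ∈ F' ↔ -v' y = 0 ∧ u' y - v' y = 0 := fun y hy => by
    rw [hF'mem y hy]; constructor <;> intro h <;> constructor <;> linarith [h.1, h.2]
  have hFli : FaceNormalForm (S' l ∩ S' i) F' (fun y => -v' y) (fun y => u' y - v' y) U
      (fun n => cf₃ n + if n = 1 then NCli.ncard else 0) :=
    face_of_implant hΘtmem hfr.isOpen_U hKXc hKXU (hfr.contMDiff_u.sub hfr.contMDiff_v) Φli hdetli hGlis hlamlis
      hOllio hFOlli hOlliU hlamlipos hGliform hGlilt hcritli hcountli hcfin_li hBxlio hKXBxli hBxliOl hlamliconst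
      hlam0li hnocritKX_li (hu's.sub hv's) hv's.neg ((hS'c l).inter (hS'c i))
      (by rw [← hF'eq]; exact fun y hy => ⟨mem_iInter.1 hy l, mem_iInter.1 hy i⟩) hF'U hQnU_li hF'li
      hQnQ_li hF'offF (fun y hy => by simp only [hu'eq y hy, hv'eq y hy]) hcornerN_li hVlio hVlisrc hKXV_li
      hNs.neg hNs hgraph_li hlam0li.ne' hGNgraph_li
      (NewCrit := NCli) (fun q => Iff.rfl) hNCli_fin
      (fun q hq => by
        rw [hNCli_eq, mem_singleton_iff] at hq
        subst hq
        rw [hqli_facts.2.2.2]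
        refine ⟨hNmorse.2 z₀ (by show z₀ ∈ criticalSet (𝓡 3) N; rw [hNcrit]; exact mem_insert _ _),
          fun _ => hiz₀, fun h => absurd h (not_lt.2 hlam0li.le)⟩)
  rw [hNCli_card] at hFli
  -- ### the face `(j, l)`: the graph `x₃ = 0`
  have hQnU_jl : ∀ y ∈ U, y ∈ S' j ∩ S' l ↔ v' y - u' y = 0 ∧ 0 ≤ -u' y := by
    intro y hy
    rw [mem_inter_iff, hS'j y hy, hS'l y hy]
    constructor
    · rintro ⟨⟨h1, h2⟩, h3, h4⟩; constructor <;> linarith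
    · rintro ⟨h1, h2⟩; refine ⟨⟨?_, ?_⟩, ?_, ?_⟩ <;> linarith
  have hQnQ_jl : ∀ y ∉ KX, y ∈ S' j ∩ S' l ↔ y ∈ S j ∩ S l := fun y hy => by
    rw [mem_inter_iff, mem_inter_iff, hS'off j y hy, hS'off l y hy]
  set Vjl : Set X := Θt.source ∩ Θt ⁻¹' {z | |z 3| < P₀ ∧ uN z < 0} ∩ Bxjl with hVjl
  have hVjlo : IsOpen Vjl := by
    refine (Θt.continuousOn.isOpen_inter_preimage Θt.open_source ?_).inter hBxjlo
    exact (isOpen_lt (continuous_abs.comp (EuclideanSpace.proj (3 : Fin 4)).continuous) continuous_const).inter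
      (isOpen_lt huNs.continuous continuous_const)
  have hVjlsrc : Vjl ⊆ Θt.source := fun y hy => hy.1.1
  have hgraph_jl : ∀ q ∈ Vjl, q ∈ S' j ∩ S' l ↔ Θt q 3 = (fun _ => (0:ℝ)) (dropLast 2 (Θt q)) := by
    rintro q ⟨⟨hqsrc, hq3, hqu⟩, -⟩
    have hqU : q ∈ U := hsrcU hqsrc
    have hqu' : uN (Θt q) < 0 := hqu
    rw [hQnU_jl q hqU, hu'src q hqsrc, hv'src q hqsrc]
    have hd := hdiffN (Θt q)
    constructor
    · rintro ⟨h1, -⟩; simp only; linarith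
    · intro h; simp only at h; constructor <;> linarith
  have hKXV_jl : ∀ y ∈ S' j ∩ S' l, y ∈ KX → y ∉ F' → y ∈ Vjl := by
    intro y hyQ hyK hyF
    have hysrc : y ∈ Θt.source := hKXsrc hyK
    have hyU : y ∈ U := hKXU hyK
    obtain ⟨hvu, hu0⟩ := (hQnU_jl y hyU).1 hyQ
    have huneg : u' y < 0 := lt_of_le_of_ne (by linarith) fun h0 => hyF ((hF'mem y hyU).2 ⟨h0, by linarith⟩)
    have h3 : Θt y 3 = 0 := by rw [← hdiffN (Θt y), ← hu'src y hysrc, ← hv'src y hysrc]; linarith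
    exact ⟨⟨hysrc, by rw [h3, abs_zero]; exact hP₀, by show uN (Θt y) < 0; rw [← hu'src y hysrc]; exact huneg⟩, hKXBxjl hyK⟩
  have hlam0jl : 0 < lamjl x := hlamjlpos x (hFOljl hx)
  have hb₀jl : -lamjl x / 2 ≠ 0 := by
    have : -lamjl x / 2 < 0 := by linarith
    exact this.ne
  have hGNgraph_jl : ∀ q ∈ Vjl, q ∈ S' j ∩ S' l →
      Gjl q + lamjl x * ((fun y => -u y) q - (fun y => -u' y) q) = 1 + (-lamjl x / 2) * N (dropLast 2 (Θt q)) := by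
    rintro q ⟨⟨hqsrc, hq3, hqu⟩, hqB⟩ hqQ
    have hq3eq : Θt q 3 = 0 := (hgraph_jl q ⟨⟨hqsrc, hq3, hqu⟩, hqB⟩).1 hqQ
    simp only
    rw [hGjlform q (hBxjlOl hqB), hlamjlconst q hqB, hu'src q hqsrc, (hslab (Θt q) hq3.le).1, hq3eq]
    ring
  set qjl : X := Θt.symm (snocEquiv 3 (z₁, 0)) with hqjl
  have hqjl_facts : qjl ∈ S' j ∩ S' l ∧ qjl ∈ KX ∧ qjl ∉ F' ∧ dropLast 2 (Θt qjl) = z₁ := by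
    obtain ⟨hKb, hT, hKX⟩ := hgraph_KX z₁ 0 hz₁K (by rw [abs_zero]; linarith)
    have hΘq : Θt qjl = snocEquiv 3 (z₁, 0) := Θt.right_inv hT
    have hsrc : qjl ∈ Θt.source := hKXsrc hKX
    have hU : qjl ∈ U := hKXU hKX
    have h3 : |snocEquiv 3 (z₁, (0:ℝ)) 3| ≤ P₀ := by rw [hlast3, abs_zero]; exact hP₀.le
    have hu0 : u' qjl = -N z₁ / 2 := by
      rw [hu'src qjl hsrc, hΘq, (hslab _ h3).1, hlast3, dropLast_snocEquiv]; ring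
    have hv0 : v' qjl = -N z₁ / 2 := by
      rw [hv'src qjl hsrc, hΘq, (hslab _ h3).2, hlast3, dropLast_snocEquiv]; ring
    refine ⟨(hQnU_jl qjl hU).2 ⟨by rw [hu0, hv0]; ring, by rw [hu0]; linarith⟩, hKX, fun hF => ?_,
      by rw [hΘq, dropLast_snocEquiv]⟩
    have := ((hF'mem qjl hU).1 hF).1
    rw [hu0] at this; linarith
  set NCjl : Set X := {q | q ∈ S' j ∩ S' l ∧ q ∈ KX ∧ q ∉ F' ∧ IsMCriticalPt (𝓡 3) N (dropLast 2 (Θt q))} with hNCjl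
  have hNCjl_eq : NCjl = {qjl} := by
    ext q
    simp only [hNCjl, mem_setOf_eq, mem_singleton_iff]
    constructor
    · rintro ⟨hqQ, hqK, hqF, hqcrit⟩
      have hqV := hKXV_jl q hqQ hqK hqF
      have hq3 : Θt q 3 = 0 := (hgraph_jl q hqV).1 hqQ
      have hneg : uN (Θt q) < 0 := hqV.1.2.2
      have hqsrc : q ∈ Θt.source := hKXsrc hqK
      have huN : uN (Θt q) = (Θt q 3 - N (dropLast 2 (Θt q))) / 2 := (hslab (Θt q) hqV.1.2.1.le).1
      rcases hcritN_mem _ hqcrit with hz | hz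
      · exfalso
        rw [huN, hq3, hz] at hneg
        linarith
      · have hΘq : Θt q = snocEquiv 3 (z₁, 0) := by
          rw [← hz, ← hq3]
          have h1 : (dropLast 2 (Θt q), Θt q (Fin.last 3)) = (snocEquiv 3).symm (Θt q) :=
            Prod.ext (by rw [dropLast_apply]) (by rw [snocEquiv_symm_apply_snd])
          show Θt q = snocEquiv 3 (dropLast 2 (Θt q), Θt q (Fin.last 3))
          rw [h1, ContinuousLinearEquiv.apply_symm_apply]
        rw [hqjl, ← hΘq, Θt.left_inv hqsrc]
    · rintro rfl
      obtain ⟨h1, h2, h3, h4⟩ := hqjl_facts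
      refine ⟨h1, h2, h3, ?_⟩
      rw [h4]; show z₁ ∈ criticalSet (𝓡 3) N; rw [hNcrit]; exact mem_insert_of_mem _ rfl
  have hNCjl_fin : NCjl.Finite := by rw [hNCjl_eq]; exact finite_singleton _
  have hNCjl_card : NCjl.ncard = 1 := by rw [hNCjl_eq, ncard_singleton]
  have hnocritKX_jl : letI := Φjl.chartedSpace
      ∀ p : ↥(S j ∩ S l), p.1 ∈ KX → ¬ IsMCriticalPt (𝓡∂ 3) (Gjl ∘ Subtype.val : ↥(S j ∩ S l) → ℝ) p :=
    fun p hp => hnocOjl p (hKXOjl hp)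
  have hcfin_jl : letI := Φjl.chartedSpace
      (criticalSet (𝓡∂ 3) (Gjl ∘ Subtype.val : ↥(S j ∩ S l) → ℝ)).Finite :=
    finite_criticalSet_face ((hT.isCompact j).inter (hT.isCompact l)) Φjl hGjls fun p hp => (hcritjl p hp).2
  have hcornerN_jl : ∀ x' ∈ F', ∃ C : CornerSliceChart (S' j) F' (fun y => v' y - u' y) (fun y => -u' y) ρ',
      x' ∈ C.Θ.source ∧ C.Θ.source ⊆ U := by
    intro x' hx'
    obtain ⟨Cn, hxCn, hCnO⟩ := hcj' x' hx'
    exact ⟨Cn, hxCn, hCnO.trans hO'U⟩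
  have hF'jl : ∀ y ∈ U, y ∈ F' ↔ v' y - u' y = 0 ∧ -u' y = 0 := fun y hy => by
    rw [hF'mem y hy]; constructor <;> intro h <;> constructor <;> linarith [h.1, h.2]
  have hFjl : FaceNormalForm (S' j ∩ S' l) F' (fun y => v' y - u' y) (fun y => -u' y) U
      (fun n => cf₂ n + if n = 1 then NCjl.ncard else 0) :=
    face_of_implant hΘtmem hfr.isOpen_U hKXc hKXU hfr.contMDiff_u.neg Φjl hdetjl hGjls hlamjls
      hOljlo hFOljl hOljlU hlamjlpos hGjlform hGjllt hcritjl hcountjl hcfin_jl hBxjlo hKXBxjl hBxjlOl hlamjlconst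
      hlam0jl hnocritKX_jl hu's.neg (hv's.sub hu's) ((hS'c j).inter (hS'c l))
      (by rw [← hF'eq]; exact fun y hy => ⟨mem_iInter.1 hy j, mem_iInter.1 hy l⟩) hF'U hQnU_jl hF'jl
      hQnQ_jl hF'offF (fun y hy => by simp only [hu'eq y hy]) hcornerN_jl hVjlo hVjlsrc hKXV_jl
      contDiff_const hNs hgraph_jl hb₀jl hGNgraph_jl
      (NewCrit := NCjl) (fun q => Iff.rfl) hNCjl_fin
      (fun q hq => by
        rw [hNCjl_eq, mem_singleton_iff] at hq
        subst hq
        rw [hqjl_facts.2.2.2]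
        refine ⟨hNmorse.2 z₁ (by show z₁ ∈ criticalSet (𝓡 3) N; rw [hNcrit]; exact mem_insert_of_mem _ rfl),
          fun h => absurd h (not_lt.2 (by linarith)), fun _ => hiz₁⟩)
  rw [hNCjl_card] at hFjl
  -- ### conclusion
  refine ⟨S', u', v', ρ', O', hTn, hagreeS, hagreeuv, ?_, ?_, ?_⟩
  · rw [hF'eq]; exact hFij
  · rw [hF'eq]; exact hFjl
  · rw [hF'eq]; exact hFli


end ImplantF

end Literature.Topology.FourManifolds
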